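import Summits.Ventures.HSemireg.ObstructionLocusBlockArrangement

/-!
# Venture HSemireg — (S5) OBSTRUCTION LOCUS away from secant type, XVIII: the BLOCK MODELS `M(S_1, …, S_r)` —
# «NO GLUING»: the explicit branch normal fields `σ_{i,a,b}(f) : I_M → R/I_M`, `u ↦ f · (u|_{x_a = 0} / x_b)`

HONEST FRAMING.  Companion of `ObstructionLocusBlockIdeal/Arrangement.lean` (cell `pub-hsemireg`, track «S4-PUSH» (ii), seat
s4-prove-2; vocabulary and honest framing as there): plain commutative algebra in `R = MvPolynomial (Fin n) K`, `K` any
commutative ring; nothing here constructs a variety or a sheaf; nothing here says that HC / HC_CM / HC_AV holds; no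
Literature fact is declared or used.  This file is the «NO GLUING» half of EXT-NOTE §6.B(a) (iv) for every block
model: for a block `i`, a generator index `a ∈ S_i`, a partner `b ∈ S_i ∖ a` (the component `B = V(x_a, x_b)`) and ANY
function `f ∈ R/(x_b, x_a) = 𝒪(B × 𝔸)`, the assignment «generator `g(α) ↦ f · g(α)/x_b` if the block-`i` index of
`α` is `a`, `↦ 0` otherwise» IS an `R`-linear map `I_M → R/I_M` (printed form, EXT-NOTE §6.B(a)(iv):
«`φ_{B,a,f}(g(α)) := −f̃ · g(α)/x_a` if `α_s = b`, `:= 0` otherwise» — the same field up to the label swap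
`(a, b) ↔ (b, a)` and the sign: `σ_{i,a,b}(f) = −φ_{B,b,f}`) — here constructed WITHOUT a presentation of `I_M`,
as `u ↦ f · T_{a,b}(u) mod I_M` with `T_{a,b}` = «delete the monomials containing `x_a`, then divide by `x_b`»
(Mathlib's `modMonomial` / `divMonomial`), whose `R`-linearity on `I_M` is checked coordinate by coordinate.

* `dropDiv a b : R →ₗ[K] R`, `coeff_dropDiv` (`coeff_s (T_{a,b} p) = [s_a = 0] · coeff_{s + 𝟙_b} p`), and its
  commutation with the coordinates: `dropDiv_X_mul_of_ne` (exact for `c ∉ {a, b}`), `dropDiv_X_mul_right` (exact for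
  `x_b` on polynomials with no monomial vanishing at both `a` and `b` — e.g. on `I_M`), `dropDiv_X_mul_left`
  (`T_{a,b}(x_a p) = 0`); values on square-free monomials `dropDiv_sq`, `dropDiv_sq_eq_zero`.
* `X_mul_dropDiv_mem`, `X_mul_dropDiv_mem'` — `x_a · T_{a,b}(u)` and `x_b · T_{a,b}(u)` lie in `I_M` for `u ∈ I_M`.
* `linearOfX` — a `K`-linear map of `R`-modules commuting with every `x_c` is `R`-linear (induction on polynomials).
* **`branchField B ha hb f : I_M →ₗ[R] R/I_M`**, `branchField_apply`; `branchFieldLin` (linear in `f`),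
  **`sigma B ha hb : R/(x_b, x_a) →ₗ[R] Hom_R(I_M, R/I_M)`** (it descends: `x_a T(u), x_b T(u) ∈ I_M`), `sigma_mk_apply`.
* Values on the test elements: `dropDiv_gen_self` (`T_{a,b}(gen i a) = genPartner i a b`), `dropDiv_gen_of_ne`,
  `dropDiv_gen_other` (`T_{a,b}` kills every other test element `gen i a'`, `gen j a'`).
References (dictionary only): EXT-NOTE.md §6.B(a) (iv) «no gluing» (the fields `φ_{B,a,f}`; source-author read of the
drafts, deform-ring2 g214: faithful, remark r1 = the label/sign convention above); G2-REDUCIBLE-POINT-THEOREM §2 L1 (i)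
(the fields `E_{kj}` of file IX are the one-block case `f = 1`).
-/

open scoped BigOperators
open MvPolynomial Finset

namespace Summit.Ventures.HSemireg.ObstructionLocus.BlockModel

variable {K : Type*} [CommRing K] {n : ℕ}

/-! ## The operator `T_{a,b}`: restrict to `x_a = 0`, divide by `x_b` -/

/-- `T_{a,b} p = (p mod x_a) / x_b`: keep the monomials of `p` not containing `x_a` and divisible by `x_b`, divided by
`x_b` (`K`-linear; Mathlib's `modMonomial ∘ divMonomial`). -/
noncomputable def dropDiv (a b : Fin n) : MvPolynomial (Fin n) K →ₗ[K] MvPolynomial (Fin n) K where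
  toFun p := (p.divMonomial (Finsupp.single b 1)).modMonomial (Finsupp.single a 1)
  map_add' p q := by
    ext s
    by_cases h : Finsupp.single a 1 ≤ s
    · simp only [coeff_add, coeff_modMonomial_of_le _ h, add_zero]
    · simp only [coeff_add, coeff_modMonomial_of_not_le _ h, coeff_divMonomial]
  map_smul' c p := by
    ext s
    by_cases h : Finsupp.single a 1 ≤ s
    · simp only [coeff_smul, coeff_modMonomial_of_le _ h, smul_zero, RingHom.id_apply]
    · simp only [coeff_smul, coeff_modMonomial_of_not_le _ h, coeff_divMonomial, RingHom.id_apply]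

/-- **The coefficients of `T_{a,b} p`.** -/
theorem coeff_dropDiv (a b : Fin n) (p : MvPolynomial (Fin n) K) (s : Fin n →₀ ℕ) :
    coeff s (dropDiv a b p) = if s a = 0 then coeff (Finsupp.single b 1 + s) p else 0 := by
  change coeff s ((p.divMonomial (Finsupp.single b 1)).modMonomial (Finsupp.single a 1)) = _
  by_cases h : s a = 0
  · rw [if_pos h, coeff_modMonomial_of_not_le, coeff_divMonomial]
    rw [Finsupp.single_le_iff]; omega
  · rw [if_neg h, coeff_modMonomial_of_le]
    rw [Finsupp.single_le_iff]; omega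

/-- The support of `T_{a,b} p`. -/
theorem mem_support_dropDiv {a b : Fin n} {p : MvPolynomial (Fin n) K} {s : Fin n →₀ ℕ} :
    s ∈ (dropDiv a b p).support ↔ s a = 0 ∧ Finsupp.single b 1 + s ∈ p.support := by
  rw [mem_support_iff, mem_support_iff, coeff_dropDiv]
  by_cases h : s a = 0
  · simp [h]
  · simp [h]

/-- A free coordinate commutes with `T_{a,b}`: `T_{a,b}(x_c p) = x_c T_{a,b}(p)` for `c ∉ {a, b}`. -/
theorem dropDiv_X_mul_of_ne {a b c : Fin n} (hca : c ≠ a) (hcb : c ≠ b) (p : MvPolynomial (Fin n) K) :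
    dropDiv a b (X c * p) = X c * dropDiv a b p := by
  classical
  ext s
  by_cases hc : c ∈ s.support
  · obtain ⟨s', rfl⟩ : ∃ s', s = Finsupp.single c 1 + s' :=
      ⟨s - Finsupp.single c 1, (add_tsub_cancel_of_le (Finsupp.single_le_iff.2
        (Nat.one_le_iff_ne_zero.2 (Finsupp.mem_support_iff.1 hc)))).symm⟩
    have h1 : (Finsupp.single c 1 + s' : Fin n →₀ ℕ) a = s' a := by
      rw [Finsupp.add_apply, Finsupp.single_apply, if_neg hca, zero_add]
    rw [coeff_X_mul, coeff_dropDiv, coeff_dropDiv, h1, add_left_comm, coeff_X_mul]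
  · have hc' : c ∉ (Finsupp.single b 1 + s).support := by
      rw [Finsupp.mem_support_iff, Finsupp.add_apply, Finsupp.single_apply, if_neg hcb.symm, zero_add, not_not]
      exact Finsupp.notMem_support_iff.1 hc
    rw [coeff_X_mul', if_neg hc, coeff_dropDiv, coeff_X_mul', if_neg hc', ite_self]

/-- `x_b` commutes with `T_{a,b}` on polynomials none of whose monomials vanishes at both `a` and `b` (e.g. on `I_M`
when `a ≠ b` lie in one block). -/
theorem dropDiv_X_mul_right {a b : Fin n} (hab : a ≠ b) {p : MvPolynomial (Fin n) K}
    (hp : ∀ s ∈ p.support, ¬ (s a = 0 ∧ s b = 0)) : dropDiv a b (X b * p) = X b * dropDiv a b p := by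
  classical
  ext s
  by_cases hb : b ∈ s.support
  · obtain ⟨s', rfl⟩ : ∃ s', s = Finsupp.single b 1 + s' :=
      ⟨s - Finsupp.single b 1, (add_tsub_cancel_of_le (Finsupp.single_le_iff.2
        (Nat.one_le_iff_ne_zero.2 (Finsupp.mem_support_iff.1 hb)))).symm⟩
    have h1 : (Finsupp.single b 1 + s' : Fin n →₀ ℕ) a = s' a := by
      rw [Finsupp.add_apply, Finsupp.single_apply, if_neg (Ne.symm hab), zero_add]
    rw [coeff_X_mul, coeff_dropDiv, coeff_dropDiv, h1, coeff_X_mul]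
  · rw [coeff_X_mul', if_neg hb, coeff_dropDiv, coeff_X_mul]
    split_ifs with ha
    · by_contra hne
      exact hp s (mem_support_iff.2 hne) ⟨ha, Finsupp.notMem_support_iff.1 hb⟩
    · rfl

/-- `T_{a,b}(x_a p) = 0`. -/
theorem dropDiv_X_mul_left {a b : Fin n} (hab : a ≠ b) (p : MvPolynomial (Fin n) K) : dropDiv a b (X a * p) = 0 := by
  classical
  ext s
  rw [coeff_dropDiv, coeff_zero]
  split_ifs with ha
  · rw [coeff_X_mul', if_neg]
    rw [Finsupp.mem_support_iff, Finsupp.add_apply, Finsupp.single_apply, if_neg (Ne.symm hab), zero_add]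
    exact fun h => h ha
  · rfl

/-- `T_{a,b}(x_T) = x_{T ∖ b}` if `a ∉ T ∋ b`. -/
theorem dropDiv_sq {a b : Fin n} {T : Finset (Fin n)} (haT : a ∉ T) (hbT : b ∈ T) :
    dropDiv a b (sq T : MvPolynomial (Fin n) K) = sq (T.erase b) := by
  classical
  ext s
  rw [coeff_dropDiv, sq_eq_monomial, sq_eq_monomial, coeff_monomial, coeff_monomial, ind_eq_single_add_erase hbT]
  by_cases hs : ind (T.erase b) = s
  · subst hs
    rw [if_pos (ind_apply_of_notMem fun h => haT (mem_erase.1 h).2), if_pos rfl, if_pos rfl]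
  · rw [if_neg hs]
    split_ifs with h1 h2
    · exact absurd (add_left_cancel h2) hs
    · rfl
    · rfl

/-- `T_{a,b}(x_T) = 0` if `a ∈ T` (`a ≠ b`). -/
theorem dropDiv_sq_eq_zero {a b : Fin n} (hab : a ≠ b) {T : Finset (Fin n)} (haT : a ∈ T) :
    dropDiv a b (sq T : MvPolynomial (Fin n) K) = 0 := by
  rw [← X_mul_sq_erase haT, dropDiv_X_mul_left hab]

/-! ## `x_a T_{a,b}(u)` and `x_b T_{a,b}(u)` stay in `I_M` -/

variable {ι : Type*}

/-- In `I_M` no monomial vanishes at two coordinates `a ≠ b` of one block. -/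
theorem not_two_zeros (B : Blocks ι n) {i : ι} {a b : Fin n} (ha : a ∈ B.S i) (hb : b ∈ (B.S i).erase a)
    {u : MvPolynomial (Fin n) K} (hu : u ∈ arrIdeal K B) : ∀ s ∈ u.support, ¬ (s a = 0 ∧ s b = 0) := by
  intro s hs hzero
  obtain ⟨a', ha', hsub⟩ := (mem_arrIdeal_iff'.1 hu) s hs i
  by_cases h : a' = a
  · subst h
    exact Finsupp.mem_support_iff.1 (hsub hb) hzero.2
  · exact Finsupp.mem_support_iff.1 (hsub (mem_erase.2 ⟨fun h' => h h'.symm, ha⟩)) hzero.1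

/-- **`x_a · T_{a,b}(u) ∈ I_M` for `u ∈ I_M`** (a monomial `x^e` of `u` with `e_a = 0`, `e_b ≥ 1` has its only
block-`i` zero at `a`; moving one `x_b` to `x_a` keeps at most one zero in block `i` and changes no other block). -/
theorem X_mul_dropDiv_mem (B : Blocks ι n) {i : ι} {a b : Fin n} (ha : a ∈ B.S i) (hb : b ∈ (B.S i).erase a)
    {u : MvPolynomial (Fin n) K} (hu : u ∈ arrIdeal K B) : X a * dropDiv a b u ∈ arrIdeal K B := by
  classical
  have hab : a ≠ b := fun h => (mem_erase.1 hb).1 h.symm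
  have hbS : b ∈ B.S i := (mem_erase.1 hb).2
  rw [mem_arrIdeal_iff']
  intro s hs j
  rw [support_X_mul, Finset.mem_map] at hs
  obtain ⟨s', hs', rfl⟩ := hs
  change BlockMem (B.S j) (Finsupp.single a 1 + s')
  obtain ⟨hs'a, hmem⟩ := mem_support_dropDiv.1 hs'
  have hBM := (mem_arrIdeal_iff'.1 hu) _ hmem j
  by_cases hj : j = i
  · subst hj
    obtain ⟨a', ha', hsub⟩ := hBM
    -- the witness for `x_b x^{s'}` must be `a` (it vanishes at `a`)
    have haa : a' = a := by
      by_contra h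
      have := hsub (mem_erase.2 ⟨fun h' => h h'.symm, ha⟩)
      rw [Finsupp.mem_support_iff, Finsupp.add_apply, Finsupp.single_apply, if_neg (Ne.symm hab), zero_add] at this
      exact this hs'a
    subst haa
    refine ⟨b, hbS, fun d hd => ?_⟩
    rw [Finsupp.mem_support_iff, Finsupp.add_apply, Finsupp.single_apply]
    by_cases hda : a' = d
    · rw [if_pos hda]; omega
    · rw [if_neg hda, zero_add]
      have hd' : d ∈ (B.S j).erase a' := mem_erase.2 ⟨fun h => hda h.symm, (mem_erase.1 hd).2⟩
      have := hsub hd'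
      rw [Finsupp.mem_support_iff, Finsupp.add_apply, Finsupp.single_apply, if_neg (mem_erase.1 hd).1.symm,
        zero_add] at this
      exact this
  · -- the other blocks do not contain the coordinates `a`, `b`
    refine (blockMem_congr fun d hd => ?_).2 hBM
    have hda : d ≠ a := fun h => Finset.disjoint_left.1 (B.disjoint (Ne.symm hj)) ha (h ▸ hd)
    have hdb : d ≠ b := fun h => Finset.disjoint_left.1 (B.disjoint (Ne.symm hj)) hbS (h ▸ hd)
    rw [Finsupp.add_apply, Finsupp.add_apply, Finsupp.single_apply, Finsupp.single_apply, if_neg hda.symm,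
      if_neg hdb.symm]

/-- **`x_b · T_{a,b}(u) ∈ I_M` for `u ∈ I_M`** (its monomials are monomials of `u`). -/
theorem X_mul_dropDiv_mem' (B : Blocks ι n) {a b : Fin n} {u : MvPolynomial (Fin n) K} (hu : u ∈ arrIdeal K B) :
    X b * dropDiv a b u ∈ arrIdeal K B := by
  classical
  rw [mem_arrIdeal_iff']
  intro s hs j
  rw [support_X_mul, Finset.mem_map] at hs
  obtain ⟨s', hs', rfl⟩ := hs
  exact (mem_arrIdeal_iff'.1 hu) _ (mem_support_dropDiv.1 hs').2 j

/-! ## From `K`-linear to `R`-linear -/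

/-- A `K`-linear map between `R`-modules (`R = K[x_1, …, x_n]`) commuting with every coordinate `x_c` is
`R`-linear (induction on polynomials). -/
noncomputable def linearOfX {M N : Type*} [AddCommGroup M] [AddCommGroup N] [Module (MvPolynomial (Fin n) K) M]
    [Module (MvPolynomial (Fin n) K) N] [Module K M] [Module K N] [IsScalarTower K (MvPolynomial (Fin n) K) M]
    [IsScalarTower K (MvPolynomial (Fin n) K) N] (f : M →ₗ[K] N)
    (hf : ∀ (c : Fin n) (m : M), f ((X c : MvPolynomial (Fin n) K) • m) = (X c : MvPolynomial (Fin n) K) • f m) :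
    M →ₗ[MvPolynomial (Fin n) K] N where
  toFun := f
  map_add' := f.map_add
  map_smul' r m := by
    change f (r • m) = r • f m
    induction r using MvPolynomial.induction_on generalizing m with
    | C c =>
      rw [← MvPolynomial.algebraMap_eq, algebraMap_smul, algebraMap_smul, f.map_smul]
    | add p q hp hq => rw [add_smul, f.map_add, hp, hq, add_smul]
    | mul_X p c hp => rw [mul_smul, hp, hf, mul_smul]

/-- The underlying function of `linearOfX f hf` is `f`. -/
theorem linearOfX_apply {M N : Type*} [AddCommGroup M] [AddCommGroup N] [Module (MvPolynomial (Fin n) K) M]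
    [Module (MvPolynomial (Fin n) K) N] [Module K M] [Module K N] [IsScalarTower K (MvPolynomial (Fin n) K) M]
    [IsScalarTower K (MvPolynomial (Fin n) K) N] (f : M →ₗ[K] N)
    (hf : ∀ (c : Fin n) (m : M), f ((X c : MvPolynomial (Fin n) K) • m) = (X c : MvPolynomial (Fin n) K) • f m)
    (m : M) : linearOfX f hf m = f m := rfl

/-! ## The branch normal fields `σ_{i,a,b}(f)` -/

/-- The `K`-linear map `u ↦ f · T_{a,b}(u) mod I_M` on `I_M`. -/
noncomputable def branchFieldK (B : Blocks ι n) (a b : Fin n) (f : MvPolynomial (Fin n) K) :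
    ↥(arrIdeal K B) →ₗ[K] MvPolynomial (Fin n) K ⧸ arrIdeal K B :=
  (Submodule.mkQ (arrIdeal K B)).restrictScalars K ∘ₗ LinearMap.mulLeft K f ∘ₗ dropDiv a b
    ∘ₗ (arrIdeal K B).subtype.restrictScalars K

/-- Its values. -/
theorem branchFieldK_apply (B : Blocks ι n) (a b : Fin n) (f : MvPolynomial (Fin n) K) (u : ↥(arrIdeal K B)) :
    branchFieldK B a b f u = Ideal.Quotient.mk (arrIdeal K B) (f * dropDiv a b u.1) := rfl

/-- **The branch normal field `σ_{i,a,b}(f) : I_M →ₗ[R] R/I_M`, `u ↦ f · T_{a,b}(u) mod I_M`** (`a ∈ S_i`,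
`b ∈ S_i ∖ a`): «`f ∂_b` on the component `V(x_a, x_b) × 𝔸`, seen on the generator `x_{S_i ∖ a}`» — EXT-NOTE
§6.B(a) (iv)'s `−φ_{B,b,f}` (label swap and sign immaterial).  `R`-linear because `T_{a,b}` commutes with the free coordinates and with `x_b` on `I_M`,
while `x_a T_{a,b}(u) ∈ I_M`. -/
noncomputable def branchField (B : Blocks ι n) {i : ι} {a b : Fin n} (ha : a ∈ B.S i) (hb : b ∈ (B.S i).erase a)
    (f : MvPolynomial (Fin n) K) :
    ↥(arrIdeal K B) →ₗ[MvPolynomial (Fin n) K] MvPolynomial (Fin n) K ⧸ arrIdeal K B :=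
  linearOfX (branchFieldK B a b f) (by
    intro c u
    have hab : a ≠ b := fun h => (mem_erase.1 hb).1 h.symm
    rw [branchFieldK_apply, branchFieldK_apply, smul_mk_eq, Submodule.coe_smul, smul_eq_mul]
    by_cases hca : c = a
    · subst hca
      rw [dropDiv_X_mul_left hab, mul_zero, map_zero, eq_comm, Ideal.Quotient.eq_zero_iff_mem, mul_left_comm]
      exact Ideal.mul_mem_left _ _ (X_mul_dropDiv_mem B ha hb u.2)
    by_cases hcb : c = b
    · subst hcb
      rw [dropDiv_X_mul_right hab (not_two_zeros B ha hb u.2), mul_left_comm]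
    · rw [dropDiv_X_mul_of_ne hca hcb, mul_left_comm])

/-- Its values: `σ_{i,a,b}(f)(u) = f · T_{a,b}(u) mod I_M`. -/
theorem branchField_apply (B : Blocks ι n) {i : ι} {a b : Fin n} (ha : a ∈ B.S i) (hb : b ∈ (B.S i).erase a)
    (f : MvPolynomial (Fin n) K) (u : ↥(arrIdeal K B)) :
    branchField B ha hb f u = Ideal.Quotient.mk (arrIdeal K B) (f * dropDiv a b u.1) := rfl

/-- `f ↦ σ_{i,a,b}(f)` is `R`-linear. -/
noncomputable def branchFieldLin (B : Blocks ι n) {i : ι} {a b : Fin n} (ha : a ∈ B.S i) (hb : b ∈ (B.S i).erase a) :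
    MvPolynomial (Fin n) K →ₗ[MvPolynomial (Fin n) K]
      (↥(arrIdeal K B) →ₗ[MvPolynomial (Fin n) K] MvPolynomial (Fin n) K ⧸ arrIdeal K B) where
  toFun f := branchField B ha hb f
  map_add' f g := by
    apply LinearMap.ext
    intro u
    rw [LinearMap.add_apply, branchField_apply, branchField_apply, branchField_apply, add_mul, map_add]
  map_smul' r f := by
    apply LinearMap.ext
    intro u
    rw [RingHom.id_apply, LinearMap.smul_apply, branchField_apply, branchField_apply, smul_mk_eq, smul_eq_mul,
      mul_assoc]

/-- `σ_{i,a,b}` kills `(x_b, x_a)`: `x_b T_{a,b}(u)` and `x_a T_{a,b}(u)` lie in `I_M`. -/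
theorem span_le_ker_branchFieldLin (B : Blocks ι n) {i : ι} {a b : Fin n} (ha : a ∈ B.S i)
    (hb : b ∈ (B.S i).erase a) :
    (Ideal.span {(X b : MvPolynomial (Fin n) K), X a} : Submodule (MvPolynomial (Fin n) K) (MvPolynomial (Fin n) K))
      ≤ LinearMap.ker (branchFieldLin B ha hb) := by
  rw [Ideal.span_le]
  intro g hg
  rw [SetLike.mem_coe, LinearMap.mem_ker]
  apply LinearMap.ext
  intro u
  change branchField B ha hb g u = 0
  rw [branchField_apply, Ideal.Quotient.eq_zero_iff_mem]
  rcases hg with rfl | hg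
  · exact X_mul_dropDiv_mem' B u.2
  · rw [Set.mem_singleton_iff] at hg
    subst hg
    exact X_mul_dropDiv_mem B ha hb u.2

/-- **«NO GLUING»: `σ_{i,a,b} : R/(x_b, x_a) →ₗ[R] Hom_R(I_M, R/I_M)`** — every function on the component
`V(x_a, x_b) × 𝔸` is the coefficient of an honest normal field of `M`. -/
noncomputable def sigma (B : Blocks ι n) {i : ι} {a b : Fin n} (ha : a ∈ B.S i) (hb : b ∈ (B.S i).erase a) :
    (MvPolynomial (Fin n) K ⧸ Ideal.span {(X b : MvPolynomial (Fin n) K), X a})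
      →ₗ[MvPolynomial (Fin n) K]
        (↥(arrIdeal K B) →ₗ[MvPolynomial (Fin n) K] MvPolynomial (Fin n) K ⧸ arrIdeal K B) :=
  Submodule.liftQ _ (branchFieldLin B ha hb) (span_le_ker_branchFieldLin B ha hb)

/-- `σ_{i,a,b}(f mod (x_b, x_a)) = σ_{i,a,b}(f)`. -/
theorem sigma_mk (B : Blocks ι n) {i : ι} {a b : Fin n} (ha : a ∈ B.S i) (hb : b ∈ (B.S i).erase a)
    (f : MvPolynomial (Fin n) K) :
    sigma B ha hb (Ideal.Quotient.mk _ f) = branchField B ha hb f := rfl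

/-! ## Values on the test elements -/

variable [Fintype ι] [DecidableEq ι]

/-- `T_{a,b}(gen i a) = genPartner i a b`. -/
theorem dropDiv_gen_self (B : Blocks ι n) {i : ι} {a b : Fin n} (ha : a ∈ B.S i) (hb : b ∈ (B.S i).erase a) :
    dropDiv a b (gen B i a : MvPolynomial (Fin n) K) = genPartner B i a b := by
  have haT : a ∉ (B.S i).erase a ∪ B.rest i := by
    rw [mem_union, not_or]
    exact ⟨Finset.notMem_erase a _, B.notMem_rest ha⟩
  rw [gen, dropDiv_sq haT (mem_union_left _ hb), genPartner, Finset.erase_union_distrib,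
    Finset.erase_eq_of_notMem (B.notMem_rest (mem_erase.1 hb).2)]

/-- `T_{a,b}(gen i a') = 0` for `a' ≠ a` in the same block. -/
theorem dropDiv_gen_of_ne (B : Blocks ι n) {i : ι} {a b a' : Fin n} (ha : a ∈ B.S i) (hb : b ∈ (B.S i).erase a)
    (h : a' ≠ a) : dropDiv a b (gen B i a' : MvPolynomial (Fin n) K) = 0 :=
  dropDiv_sq_eq_zero (fun h' => (mem_erase.1 hb).1 h'.symm) (mem_union_left _ (mem_erase.2 ⟨h.symm, ha⟩))

/-- `T_{a,b}(gen j a') = 0` for every other block `j ≠ i`. -/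
theorem dropDiv_gen_other (B : Blocks ι n) {i j : ι} {a b a' : Fin n} (ha : a ∈ B.S i) (hb : b ∈ (B.S i).erase a)
    (hj : j ≠ i) : dropDiv a b (gen B j a' : MvPolynomial (Fin n) K) = 0 :=
  dropDiv_sq_eq_zero (fun h' => (mem_erase.1 hb).1 h'.symm) (mem_union_right _ (B.mem_rest (Ne.symm hj) ha))

end Summit.Ventures.HSemireg.ObstructionLocus.BlockModel
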